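import Summits.ResolutionOfSingularities.ResolutionOfSingularities.Theorems.IndSmoothValuativeSmoothingQuadraticSequence
import Summits.ResolutionOfSingularities.ResolutionOfSingularities.Theorems.IndSmoothValuativeSmoothingSequenceCollapse
import Summits.ResolutionOfSingularities.ResolutionOfSingularities.Theorems.IndSmoothValuativeSmoothingSmoothFactorOfLocAtCentre
import Summits.ResolutionOfSingularities.ResolutionOfSingularities.Theorems.IndSmoothValuativeSmoothingDominatesDimLeOne
import Summits.ResolutionOfSingularities.ResolutionOfSingularities.Theorems.IndSmoothValuativeSmoothingPolynomialModel
import Literature.AlgebraicGeometry.Resolution.QuadraticTransformsProofs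
import Mathlib.RingTheory.KrullDimension.Field
import HarnessLib

/-!
# The crux `IndSmooth.ValuativeSmoothing` at valuation rings with a REGULAR CENTRE OF DIMENSION ≤ 2
# on some affine model; hence at ALL valuation rings of `k(x, y)` (Zariski 1939 / Abhyankar 1956)

Support file for crux stmt-ResolutionOfSingularities-16087 (`ValuativeSmoothing`, route file
`Theses/IndSmooth.lean`), lead reshape r5 of line `birth`: the FOURTH proved family of the crux.

For `k` PERFECT (no characteristic hypothesis), ANY field `K ⊇ k`, a valuation ring `O` of `K`
and a finitely generated `k`-subalgebra `B ⊆ O` with `Frac B = K` whose local ring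
`B_𝔭 = locAtCentre B O` at the centre `𝔭 = 𝔪_O ∩ B` is a REGULAR local ring of Krull dimension
`≤ 2`, every finitely generated `k`-subalgebra `R ⊆ O` factors `R → T → O` through a SMOOTH
`k`-algebra `T` — the conclusion of `ValuativeSmoothing` at `O` (`smoothFactor_of_regularCentre`).
Corollary (`smoothFactor_of_purelyTranscendental_two`): for `K = k(x, y)` purely transcendental
of transcendence degree two, EVERY valuation ring `O ⊇ k` of `K` has this property — including
the rank-one, non-discrete (`Γ ≅ ℤ[1/p]`), residually trivial DEFECT valuations, which are
zero-dimensional, non-Noetherian, non-Abhyankar and have no discrete chain, i.e. lie in the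
open core left by the three earlier families (Noetherian p156666, Abhyankar places p153647,
discrete jumps p164049).

**Proof.** Put `R₀ = B_𝔭`; it is dominated by `O` and has fraction field `K`.
* `dim R₀ ≤ 1`: `R₀` is a field or a discrete valuation ring, hence a valuation ring of `K`
  dominated by `O`, so `O = R₀` (`stub_eqOfDominatesOfDimLeOne`, p168200); then `R ⊆ R₀` and
  "regular at the centre over a perfect field ⇒ smooth basic open neighbourhood inside `O`"
  (`stub_smoothFactorOfLocAtCentre`, p168077, from `stub_smoothNbhd`, p153448) gives `T`.
* `dim R₀ = 2`: then `O ≠ K`, and the quadratic sequence `R₀ = R 0 → R 1 → ⋯` of `R₀` along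
  `O` exists (`stub_quadraticSequence`, p167775: blow up the maximal ideal, localise at the
  centre of `O`, repeat — each member is again a regular local ring). By ABHYANKAR'S UNION LEMMA
  (Abhyankar 1956, Lemma 12 = Cutkosky 2014, Lemma 2.2; PROVED in the tree,
  `AbhyankarQuadraticUnion_holds`) `O = ⋃ R n`, so the finitely many generators of `R` lie in
  some `R N`; `R N` is regular (`isRegularLocalRing_sequence`) and is the local ring at the
  centre of `O` of a finitely generated `B[t] ⊆ O` (towers of local blowing ups collapse,
  `stub_sequenceCollapse`, p167936); conclude by `stub_smoothFactorOfLocAtCentre` again.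
* `K = k(x,y)`: `B = k[x^{±1}, y^{±1}] ⊆ O` is a polynomial ring in an algebraically independent
  pair, regular of dimension `2` (`stub_polynomialModel`, p168565).

## Sources

* S. S. Abhyankar, *On the valuations centered in a local domain*, Amer. J. Math. 78 (1956),
  Lemma 12. [Abhyankar1956Valuations]
* O. Zariski, *The reduction of the singularities of an algebraic surface*, Ann. Math. 40
  (1939) (uniformization of zero-dimensional valuations centred at a simple point).
* S. D. Cutkosky, Math. Ann. 362 (2015), Lemma 2.2. [Cutkosky2014]
-/

-- single-problem summit: the doubled namespace component is forced
set_option linter.dupNamespace false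

namespace Summit.ResolutionOfSingularities.ResolutionOfSingularities.Theorems.ValuativeSmoothing

open IsLocalRing Literature.AlgebraicGeometry.Resolution

/-- A local subring of `K` dominated by the trivial valuation ring `K` is a field, so it has
Krull dimension `0`. [folklore] -/
theorem ringKrullDim_eq_zero_of_subringDominates_top {K : Type} [Field K] (R₀ : Subring K)
    (hdom : SubringDominates R₀ (⊤ : ValuationSubring K).toSubring) : ringKrullDim R₀ = 0 := by
  refine ringKrullDim_eq_zero_of_isField ?_
  refine ⟨⟨0, 1, zero_ne_one⟩, mul_comm, fun {a} ha => ?_⟩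
  have ha0 : (a : K) ≠ 0 := fun h => ha (Subtype.ext h)
  have hinv : (a : K)⁻¹ ∈ R₀ := hdom.2 a a.2 (Subring.mem_top _)
  exact ⟨⟨(a : K)⁻¹, hinv⟩, Subtype.ext (mul_inv_cancel₀ ha0)⟩

/-- In a Noetherian local ring, Krull dimension `≤ 2` and not `≤ 1` means dimension `2`
(the dimension is the height of the maximal ideal, a natural number). [folklore] -/
theorem ringKrullDim_eq_two_of_le_two {A : Type} [CommRing A] [IsLocalRing A] [IsNoetherianRing A]
    (h2 : ringKrullDim A ≤ 2) (h1 : ¬ ringKrullDim A ≤ 1) : ringKrullDim A = 2 := by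
  have hne : (IsLocalRing.maximalIdeal A).height ≠ ⊤ := Ideal.height_ne_top_of_isPrime
  obtain ⟨m, hm⟩ := ENat.ne_top_iff_exists.mp hne
  have hd : ringKrullDim A = (m : WithBot ℕ∞) := by
    rw [← IsLocalRing.maximalIdeal_height_eq_ringKrullDim, ← hm]
    rfl
  rw [hd] at h2 h1 ⊢
  have h2' : m ≤ 2 := by exact_mod_cast h2
  have h1' : ¬ m ≤ 1 := fun h => h1 (by exact_mod_cast h)
  have : m = 2 := by omega
  subst this
  rfl

/-- **The crux `ValuativeSmoothing` at valuation rings with a regular centre of dimension `≤ 2`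
on some affine model** (the fourth proved family; Zariski 1939 / Abhyankar 1956, Lemma 12, in
ind-smooth clothing). For `k` perfect, a field `K ⊇ k`, a valuation ring `O` of `K` and a
finitely generated `k`-subalgebra `B ⊆ O` with `Frac B = K` such that `locAtCentre B O` (the
local ring of `B` at the centre of `O`) is a regular local ring of Krull dimension `≤ 2`, every
finitely generated `k`-subalgebra `R ⊆ O` factors `R → T → O ⊆ K` through a smooth `k`-algebra
`T`. Dimension `≤ 1`: `O = locAtCentre B O` (`stub_eqOfDominatesOfDimLeOne`) and
`stub_smoothFactorOfLocAtCentre`. Dimension `2`: `O ≠ K`; the quadratic sequence along `O`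
(`stub_quadraticSequence`) has union `O` (`AbhyankarQuadraticUnion_holds`), so the generators
of `R` lie in a member `R N`, regular (`isRegularLocalRing_sequence`) and equal to the local
ring at the centre of a finitely generated `B[t] ⊆ O` (`stub_sequenceCollapse`); conclude by
`stub_smoothFactorOfLocAtCentre`. [cite: Abhyankar1956Valuations, Lemma 12] -/
theorem smoothFactor_of_regularCentre (k K : Type) [Field k] [PerfectField k] [Field K]
    [Algebra k K] (O : ValuationSubring K) (B : Subalgebra k K) (hBfg : B.FG)
    (hBO : B.toSubring ≤ O.toSubring) (hfrac : ∀ z : K, ∃ a ∈ B, ∃ b ∈ B, b ≠ 0 ∧ z = a / b)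
    (hreg : IsRegularLocalRing (locAtCentre B.toSubring O))
    (hdim : ringKrullDim (locAtCentre B.toSubring O) ≤ 2)
    (R : Subalgebra k K) (hR : R.FG) (hRO : R.toSubring ≤ O.toSubring) :
    ∃ (T : Type) (_ : CommRing T) (_ : Algebra k T), Algebra.Smooth k T ∧
      ∃ (ψ : R →ₐ[k] T) (χ : T →ₐ[k] K), (∀ t : T, χ t ∈ O) ∧ ∀ r : R, χ (ψ r) = (r : K) := by
  classical
  haveI := hreg
  have hdom : SubringDominates (locAtCentre B.toSubring O) O.toSubring :=
    subringDominates_locAtCentre hBO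
  have hof : IsLocalRingOf (locAtCentre B.toSubring O) := by
    refine ⟨inferInstance, fun z => ?_⟩
    obtain ⟨a, ha, b, hb, hb0, rfl⟩ := hfrac z
    exact ⟨a, le_locAtCentre _ O ha, b, le_locAtCentre _ O hb, hb0, rfl⟩
  by_cases h1 : ringKrullDim (locAtCentre B.toSubring O) ≤ 1
  · -- dimension ≤ 1: `O` is the local ring at the centre itself
    have hO : O.toSubring = locAtCentre B.toSubring O :=
      stub_eqOfDominatesOfDimLeOne O _ hreg h1 hof hdom
    exact stub_smoothFactorOfLocAtCentre k K O B hBfg hBO hreg R hR (hO ▸ hRO)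
  -- dimension 2: the quadratic sequence along `O`
  have h2 : ringKrullDim (locAtCentre B.toSubring O) = 2 := ringKrullDim_eq_two_of_le_two hdim h1
  have hOtop : O ≠ ⊤ := by
    rintro rfl
    have h0 := ringKrullDim_eq_zero_of_subringDominates_top _ hdom
    rw [h0] at h2
    exact absurd h2 (by decide)
  obtain ⟨Rs, hRs0, hstep⟩ := stub_quadraticSequence O hOtop _ hreg hof hdom
  have hreg0 : IsRegularLocalRing (Rs 0) := by rw [hRs0]; exact hreg
  have h20 : ringKrullDim (Rs 0) = 2 := by rw [hRs0]; exact h2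
  have hof0 : IsLocalRingOf (Rs 0) := by rw [hRs0]; exact hof
  have hdom0 : SubringDominates (Rs 0) O.toSubring := by rw [hRs0]; exact hdom
  have hunion := AbhyankarQuadraticUnion_holds K O Rs hreg0 h20 hof0 hdom0 hstep
  -- the generators of `R` lie in some `Rs N`
  obtain ⟨s, hs⟩ := hR
  have hmono := sequence_monotone hstep
  have hsN : ∃ N, (↑s : Set K) ⊆ Rs N := by
    have hx : ∀ x ∈ s, ∃ i, x ∈ Rs i := fun x hx =>
      (hunion x).mp (hRO (hs ▸ Algebra.subset_adjoin hx))
    choose i hi using hx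
    refine ⟨s.attach.sup fun x => i x.1 x.2, fun x hx => ?_⟩
    exact hmono (Finset.le_sup (f := fun x : {x // x ∈ s} => i x.1 x.2) (Finset.mem_attach s ⟨x, hx⟩))
      (hi x hx)
  obtain ⟨N, hN⟩ := hsN
  obtain ⟨t, htO, hRN'⟩ := stub_sequenceCollapse O B.toSubring hBO Rs hRs0 hstep N
  have hRN : Rs N = locAtCentre (Subring.closure ((B : Set K) ∪ ↑t)) O := hRN'
  -- the finitely generated model `C = B[t] ⊆ O`
  let C : Subalgebra k K := Algebra.adjoin k ((B : Set K) ∪ ↑t)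
  have hC : C.toSubring = Subring.closure ((B : Set K) ∪ ↑t) := by
    change (Algebra.adjoin k ((B : Set K) ∪ ↑t)).toSubring = _
    rw [Algebra.adjoin_eq_ring_closure]
    apply le_antisymm
    · refine Subring.closure_le.mpr ?_
      rintro z (⟨c, rfl⟩ | hz)
      · exact Subring.subset_closure (Or.inl (B.algebraMap_mem c))
      · exact Subring.subset_closure hz
    · exact Subring.closure_mono Set.subset_union_right
  have hCfg : C.FG := by
    change (Algebra.adjoin k ((B : Set K) ∪ ↑t)).FG
    rw [Algebra.adjoin_union, Algebra.adjoin_eq B]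
    exact hBfg.sup (Subalgebra.fg_adjoin_finset t)
  have hCO : C.toSubring ≤ O.toSubring := by
    rw [hC]
    exact Subring.closure_le.mpr (Set.union_subset hBO htO)
  have hregC : IsRegularLocalRing (locAtCentre C.toSubring O) := by
    rw [hC, ← hRN]
    exact isRegularLocalRing_sequence hreg0 hstep N
  have hRC : R.toSubring ≤ locAtCentre C.toSubring O := by
    rw [hC, ← hRN, ← hs]
    have hk : ∀ c : k, algebraMap k K c ∈ Rs N := fun c =>
      hmono (Nat.zero_le N) (hRs0 ▸ le_locAtCentre _ O (B.algebraMap_mem c))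
    change Algebra.adjoin k (↑s : Set K) ≤ (⟨(Rs N).toSubsemiring, hk⟩ : Subalgebra k K)
    exact Algebra.adjoin_le hN
  exact stub_smoothFactorOfLocAtCentre k K O C hCfg hCO hregC R ⟨s, hs⟩ hRC

/-- **Every valuation ring of a purely transcendental extension of transcendence degree two
over a perfect field satisfies the crux `ValuativeSmoothing`.** For `k` perfect (any
characteristic), `K = k(x, y)` with `(x, y)` algebraically independent over `k`, EVERY
valuation ring `O ⊇ k` of `K` and every finitely generated `k`-subalgebra `R ⊆ O`, the inclusion
`R → O` factors `R → T → O ⊆ K` through a smooth `k`-algebra `T`: the polynomial model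
`k[x^{±1}, y^{±1}] ⊆ O` is regular of dimension `2` (`stub_polynomialModel`), so
`smoothFactor_of_regularCentre` applies. This family contains rank-one DEFECT valuations with
dense value group (`Γ ≅ ℤ[1/p]`, `κ = k`; Mac Lane–Schilling), members of the open core of the
one-root kernel of line `birth` after reshape r4. [cite: Abhyankar1956Valuations, Lemma 12] -/
theorem smoothFactor_of_purelyTranscendental_two (k K : Type) [Field k] [PerfectField k]
    [Field K] [Algebra k K] (x y : K) (hxy : AlgebraicIndependent k ![x, y])
    (hgen : ∀ z : K, ∃ a ∈ Algebra.adjoin k {x, y}, ∃ b ∈ Algebra.adjoin k {x, y},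
      b ≠ 0 ∧ z = a / b)
    (O : ValuationSubring K) (hO : ∀ c : k, algebraMap k K c ∈ O)
    (R : Subalgebra k K) (hR : R.FG) (hRO : R.toSubring ≤ O.toSubring) :
    ∃ (T : Type) (_ : CommRing T) (_ : Algebra k T), Algebra.Smooth k T ∧
      ∃ (ψ : R →ₐ[k] T) (χ : T →ₐ[k] K), (∀ t : T, χ t ∈ O) ∧ ∀ r : R, χ (ψ r) = (r : K) := by
  obtain ⟨B, hBfg, hBO, hfrac, hreg, hdim⟩ := stub_polynomialModel k K x y hxy hgen O hO
  exact smoothFactor_of_regularCentre k K O B hBfg hBO hfrac hreg hdim R hR hRO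

end Summit.ResolutionOfSingularities.ResolutionOfSingularities.Theorems.ValuativeSmoothing
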